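import Literature.Probability.Percolation.ArmSeparationProofs
import HarnessLib

/-!
# Non-vacuity of the well-separated two-arm events (sanity check of `Nolin2008_twoArm_separation`)

Topic: Probability / Percolation; family `crit-perc`. The named fact
`Literature.Probability.Percolation.Nolin2008_twoArm_separation` (`ArmSeparation.lean`; Nolin
2008, Thm. 11 [arXiv 0711.4948: Thm. 10] for `j = 2`) asserts
`c · b(n, N) ≤ P_{1/2}(sepTwoArm n N)` for large `n` and `N ≥ 2n`; since `b(n, N) > 0`
(`polyArmProb_twoArm_pos`, `ArmEventsProofs.lean`), it can only hold if the Lean rendering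
`sepTwoArm n N` of Nolin's well-separated event `Ã̃` (fences off the annulus, landing zones on the
middle halves of the right/left sides, attaching balls) has positive probability. This file
PROVES that necessary condition (`triSitePercolation_sepTwoArm_pos`: `P_{1/2}(sepTwoArm n N) > 0`
for all `16 ≤ n ≤ N`), through the explicit membership of the right half-plane configuration
`{x₀ > 0}` (`halfPlane_mem_sepTwoArm`, the non-vacuity statement announced in the docstring of
`ArmSeparation.lean`) and the locality of the event (`determinedBy_sepOpenArm`,
`ArmSeparationProofs.lean`). Everything here is proved; no definitions are introduced.

Contents: straight lattice segments as `PathIn` (`pathIn_hSegment`, `pathIn_vSegment_up`,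
`pathIn_vSegment_down`), coordinates of `![a, b] : Site 2` (`site_mk_apply_zero`,
`site_mk_apply_one`, `site_mk_add_triE0`), `halfPlane_mem_sepOpenArm`, `halfPlane_mem_sepTwoArm`,
`triSitePercolation_sepTwoArm_pos`.

References: P. Nolin, *Near-critical percolation in two dimensions*, EJP 13 (2008), §4.1
(`n₀(j)`: "we can then draw straight lines heading toward the exterior"), §4.2 (free spaces),
Thm. 11 [arXiv Thm. 10]. [Nolin2008]

Mathlib search: no percolation in Mathlib; used: `Matrix.vecCons` notation, `Fin` case analysis.
Tree: `ArmSeparation.lean` (`sepOpenArm`, `sepTwoArm`, fences), `ArmSeparationProofs.lean`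
(`determinedBy_sepOpenArm`, `isUpperSet_sepOpenArm`, `DeterminedBy.preimage_negFlip`),
`ArmSeparationGlue.lean` (`sepSupportSet`), `ArmEventsProofs.lean`
(`TwoArmPos.triSitePercolation_half_cylinder_pos`), `ArmEventsAPriori.lean` (`triNorm`
arithmetic), `TriHexLemma.lean` (`triE0`, `triE1`, `triGraph_adj_add_triE0/1`).
-/

noncomputable section

open MeasureTheory Set

namespace Literature.Probability.Percolation

open LatticeModels

/-! ### Straight lattice segments as `PathIn` -/

/-- A horizontal lattice segment `{(a + i, y) : i ≤ m}` all of whose sites lie in `A` is a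
`𝕋`-path inside `A` (steps `+ e₀`). [folklore] -/
theorem pathIn_hSegment {A : Set (Site 2)} {a y : ℤ} (m : ℕ)
    (h : ∀ i : ℕ, i ≤ m → (![a + i, y] : Site 2) ∈ A) :
    PathIn triGraph A ![a, y] ![a + m, y] := by
  induction m with
  | zero => simpa using PathIn.refl (h 0 le_rfl)
  | succ m ih =>
    have ih' := ih fun i hi => h i (Nat.le_succ_of_le hi)
    have hadj : triGraph.Adj (![a + (m : ℕ), y] : Site 2) ![a + ((m + 1 : ℕ) : ℤ), y] := by
      have : (![a + ((m + 1 : ℕ) : ℤ), y] : Site 2) = ![a + (m : ℕ), y] + triE0 := by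
        ext j; fin_cases j <;> simp [add_assoc]
      rw [this]; exact triGraph_adj_add_triE0 _
    exact ih'.tail hadj (h (m + 1) le_rfl)

/-- A vertical lattice segment `{(x, t + i) : i ≤ m}` all of whose sites lie in `A` is a
`𝕋`-path inside `A` (steps `+ e₁`). [folklore] -/
theorem pathIn_vSegment_up {A : Set (Site 2)} {x t : ℤ} (m : ℕ)
    (h : ∀ i : ℕ, i ≤ m → (![x, t + i] : Site 2) ∈ A) :
    PathIn triGraph A ![x, t] ![x, t + m] := by
  induction m with
  | zero => simpa using PathIn.refl (h 0 le_rfl)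
  | succ m ih =>
    have ih' := ih fun i hi => h i (Nat.le_succ_of_le hi)
    have hadj : triGraph.Adj (![x, t + (m : ℕ)] : Site 2) ![x, t + ((m + 1 : ℕ) : ℤ)] := by
      have : (![x, t + ((m + 1 : ℕ) : ℤ)] : Site 2) = ![x, t + (m : ℕ)] + triE1 := by
        ext j; fin_cases j <;> simp [add_assoc]
      rw [this]; exact triGraph_adj_add_triE1 _
    exact ih'.tail hadj (h (m + 1) le_rfl)

/-- A vertical lattice segment `{(x, t - i) : i ≤ m}` all of whose sites lie in `A` is a
`𝕋`-path inside `A` (steps `- e₁`). [folklore] -/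
theorem pathIn_vSegment_down {A : Set (Site 2)} {x t : ℤ} (m : ℕ)
    (h : ∀ i : ℕ, i ≤ m → (![x, t - i] : Site 2) ∈ A) :
    PathIn triGraph A ![x, t] ![x, t - m] := by
  have h' : ∀ i : ℕ, i ≤ m → (![x, (t - m) + i] : Site 2) ∈ A := by
    intro i hi
    have := h (m - i) (by omega)
    have e : (t : ℤ) - ((m - i : ℕ) : ℤ) = t - m + i := by push_cast [Nat.cast_sub hi]; ring
    rwa [e] at this
  have p := pathIn_vSegment_up m h'
  have e : (t : ℤ) - m + m = t := by ring
  rw [e] at p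
  exact p.symm


/-! ### The right half-plane configuration is a well-separated two-arm configuration -/

/-- Evaluation of a lattice point. [folklore] -/
theorem site_mk_apply_zero (a b : ℤ) : (![a, b] : Site 2) 0 = a := rfl

/-- Evaluation of a lattice point. [folklore] -/
theorem site_mk_apply_one (a b : ℤ) : (![a, b] : Site 2) 1 = b := rfl

/-- `![a, b] + e₀ = ![a + 1, b]`. [folklore] -/
theorem site_mk_add_triE0 (a b : ℤ) : (![a, b] : Site 2) + triE0 = ![a + 1, b] := by
  ext j; fin_cases j <;> simp

/-- **Non-vacuity of the fenced open arm.** For `16 ≤ n ≤ N` the right half-plane configuration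
`{x₀ > 0}` lies in `sepOpenArm n N`: with the landing sites `z' = (n, -n/4)`, `z = (N, -N/4)`,
the columns `x₀ = n - 1` and `x₀ = N + 1` cross the inner and outer free spaces vertically, and
the path `(n-1, -n/4) → (n, -n/4) → (N, -n/4) → (N, -N/4) → (N+1, -N/4)` (a horizontal segment
in the cone `{-x₀ ≤ x₁ ≤ 0}`, where `|·|_𝕋 = x₀`, then a vertical segment on the right side of
`∂Λ_N`) joins them inside the annulus and the two attaching balls. (Sanity check of the
definitions of `ArmSeparation.lean`; Nolin 2008, §4.1: arm events are non-empty from `n₀(j)` on,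
"we can then draw straight lines heading toward the exterior".) [cite: Nolin2008, §4.1 (n₀(j))] -/
theorem halfPlane_mem_sepOpenArm {n N : ℕ} (hn : 16 ≤ n) (hnN : n ≤ N) :
    {v : Site 2 | 0 < v 0} ∈ sepOpenArm n N := by
  have hN : 16 ≤ N := hn.trans hnN
  have hnN' : (n : ℤ) ≤ N := by exact_mod_cast hnN
  set ω : Set (Site 2) := {v : Site 2 | 0 < v 0} with hω
  set z : Site 2 := ![(N : ℤ), -((N / 4 : ℕ) : ℤ)] with hz
  set z' : Site 2 := ![(n : ℤ), -((n / 4 : ℕ) : ℤ)] with hz'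
  set u : Site 2 := ![(n : ℤ) - 1, -((n / 4 : ℕ) : ℤ)] with hu
  set u' : Site 2 := ![(N : ℤ) + 1, -((N / 4 : ℕ) : ℤ)] with hu'
  have hzL : z ∈ sepLanding N := by
    rw [mem_sepLanding, hz, site_mk_apply_zero, site_mk_apply_one]; omega
  have hz'L : z' ∈ sepLanding n := by
    rw [mem_sepLanding, hz', site_mk_apply_zero, site_mk_apply_one]; omega
  refine ⟨z, z', u, u', hzL, hz'L, ?_, ?_, ?_⟩
  · -- the inner free space is crossed vertically by the column `x₀ = n - 1`
    refine ⟨![(n : ℤ) - 1, -((n / 4 : ℕ) : ℤ) - (n / 64 : ℕ)], ![(n : ℤ) - 1, -((n / 4 : ℕ) : ℤ) + (n / 64 : ℕ)],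
      by rw [hz', site_mk_apply_one, site_mk_apply_one], by rw [hz', site_mk_apply_one, site_mk_apply_one], ?_, ?_⟩
    · have p := pathIn_vSegment_up (A := sepInnerFence n z' ∩ ω) (x := (n : ℤ) - 1)
        (t := -((n / 4 : ℕ) : ℤ) - (n / 64 : ℕ)) (n / 64) (fun i hi => by
          refine ⟨?_, ?_⟩
          · rw [mem_sepInnerFence, hz', site_mk_apply_zero, site_mk_apply_one, site_mk_apply_one]; omega
          · rw [hω, mem_setOf_eq, site_mk_apply_zero]; omega)
      have e : -((n / 4 : ℕ) : ℤ) - ((n / 64 : ℕ) : ℤ) + ((n / 64 : ℕ) : ℤ) = -((n / 4 : ℕ) : ℤ) := by ring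
      rw [e] at p; exact p
    · exact pathIn_vSegment_up (A := sepInnerFence n z' ∩ ω) (x := (n : ℤ) - 1)
        (t := -((n / 4 : ℕ) : ℤ)) (n / 64) (fun i hi => by
          refine ⟨?_, ?_⟩
          · rw [mem_sepInnerFence, hz', site_mk_apply_zero, site_mk_apply_one, site_mk_apply_one]; omega
          · rw [hω, mem_setOf_eq, site_mk_apply_zero]; omega)
  · -- the outer free space is crossed vertically by the column `x₀ = N + 1`
    refine ⟨![(N : ℤ) + 1, -((N / 4 : ℕ) : ℤ) - (N / 64 : ℕ)], ![(N : ℤ) + 1, -((N / 4 : ℕ) : ℤ) + (N / 64 : ℕ)],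
      by rw [hz, site_mk_apply_one, site_mk_apply_one], by rw [hz, site_mk_apply_one, site_mk_apply_one], ?_, ?_⟩
    · have p := pathIn_vSegment_up (A := sepOuterFence N z ∩ ω) (x := (N : ℤ) + 1)
        (t := -((N / 4 : ℕ) : ℤ) - (N / 64 : ℕ)) (N / 64) (fun i hi => by
          refine ⟨?_, ?_⟩
          · rw [mem_sepOuterFence, hz, site_mk_apply_zero, site_mk_apply_one, site_mk_apply_one]; omega
          · rw [hω, mem_setOf_eq, site_mk_apply_zero]; omega)
      have e : -((N / 4 : ℕ) : ℤ) - ((N / 64 : ℕ) : ℤ) + ((N / 64 : ℕ) : ℤ) = -((N / 4 : ℕ) : ℤ) := by ring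
      rw [e] at p; exact p
    · exact pathIn_vSegment_up (A := sepOuterFence N z ∩ ω) (x := (N : ℤ) + 1)
        (t := -((N / 4 : ℕ) : ℤ)) (N / 64) (fun i hi => by
          refine ⟨?_, ?_⟩
          · rw [mem_sepOuterFence, hz, site_mk_apply_zero, site_mk_apply_one, site_mk_apply_one]; omega
          · rw [hω, mem_setOf_eq, site_mk_apply_zero]; omega)
  · -- the joining path `u → (n, -n/4) → (N, -n/4) → (N, -N/4) → u'`
    have hann : ∀ x y : ℤ, (n : ℤ) ≤ x → x ≤ N → y ≤ 0 → -x ≤ y →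
        (![x, y] : Site 2) ∈ sepJoinRegion n N z z' ∩ ω := by
      intro x y h1 h2 h3 h4
      refine ⟨Or.inl (Or.inl ?_), ?_⟩
      · rw [mem_triAnnulusSet, triNorm_eq_apply_zero (x := ![x, y]) h3 (by rw [site_mk_apply_zero, site_mk_apply_one]; omega),
          site_mk_apply_zero]
        exact ⟨h1, h2⟩
      · rw [hω, mem_setOf_eq, site_mk_apply_zero]; omega
    have huJ : u ∈ sepJoinRegion n N z z' ∩ ω := by
      refine ⟨Or.inr ?_, by rw [hω, mem_setOf_eq, hu, site_mk_apply_zero]; omega⟩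
      rw [mem_triOpenBall, triNorm_lt_iff_lin]
      simp only [hu, hz', Pi.sub_apply, site_mk_apply_zero, site_mk_apply_one]; omega
    have hu'J : u' ∈ sepJoinRegion n N z z' ∩ ω := by
      refine ⟨Or.inl (Or.inr ?_), by rw [hω, mem_setOf_eq, hu', site_mk_apply_zero]; omega⟩
      rw [mem_triOpenBall, triNorm_lt_iff_lin]
      simp only [hu', hz, Pi.sub_apply, site_mk_apply_zero, site_mk_apply_one]; omega
    -- segment 1
    have s₁ : PathIn triGraph (sepJoinRegion n N z z' ∩ ω) u ![(n : ℤ), -((n / 4 : ℕ) : ℤ)] := by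
      refine PathIn.of_adj huJ (hann _ _ le_rfl hnN' (by omega) (by omega)) ?_
      have e : (![(n : ℤ), -((n / 4 : ℕ) : ℤ)] : Site 2) = u + triE0 := by
        rw [hu, site_mk_add_triE0]; congr 1; ring
      rw [e]; exact triGraph_adj_add_triE0 _
    -- segment 2
    have s₂ : PathIn triGraph (sepJoinRegion n N z z' ∩ ω) ![(n : ℤ), -((n / 4 : ℕ) : ℤ)]
        ![(N : ℤ), -((n / 4 : ℕ) : ℤ)] := by
      have p := pathIn_hSegment (A := sepJoinRegion n N z z' ∩ ω) (a := (n : ℤ)) (y := -((n / 4 : ℕ) : ℤ))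
        (N - n) (fun i hi => hann _ _ (by omega) (by omega) (by omega) (by omega))
      have e : (n : ℤ) + ((N - n : ℕ) : ℤ) = N := by push_cast [Nat.cast_sub hnN]; ring
      rw [e] at p; exact p
    -- segment 3
    have s₃ : PathIn triGraph (sepJoinRegion n N z z' ∩ ω) ![(N : ℤ), -((n / 4 : ℕ) : ℤ)]
        ![(N : ℤ), -((N / 4 : ℕ) : ℤ)] := by
      have h44 : n / 4 ≤ N / 4 := Nat.div_le_div_right hnN
      have p := pathIn_vSegment_down (A := sepJoinRegion n N z z' ∩ ω) (x := (N : ℤ)) (t := -((n / 4 : ℕ) : ℤ))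
        (N / 4 - n / 4) (fun i hi => hann _ _ hnN' le_rfl (by omega) (by omega))
      have e : -((n / 4 : ℕ) : ℤ) - ((N / 4 - n / 4 : ℕ) : ℤ) = -((N / 4 : ℕ) : ℤ) := by
        push_cast [Nat.cast_sub h44]; ring
      rw [e] at p; exact p
    -- segment 4
    have s₄ : PathIn triGraph (sepJoinRegion n N z z' ∩ ω) ![(N : ℤ), -((N / 4 : ℕ) : ℤ)] u' := by
      refine PathIn.of_adj (hann _ _ hnN' le_rfl (by omega) (by omega)) hu'J ?_
      rw [hu', ← site_mk_add_triE0]; exact triGraph_adj_add_triE0 _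
    exact ((s₁.trans s₂).trans s₃).trans s₄

/-- **Non-vacuity of the well-separated two-arm event.** For `16 ≤ n ≤ N` the right half-plane
configuration `{x₀ > 0}` lies in `sepTwoArm n N`: its image under `negFlip` is the closed
half-plane configuration `{x₀ ≥ 0} ⊇ {x₀ > 0}`, and the fenced open arm is an increasing event. [cite: Nolin2008, §4.1 (n₀(j))] -/
theorem halfPlane_mem_sepTwoArm {n N : ℕ} (hn : 16 ≤ n) (hnN : n ≤ N) :
    {v : Site 2 | 0 < v 0} ∈ sepTwoArm n N := by
  refine ⟨halfPlane_mem_sepOpenArm hn hnN, ?_⟩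
  have hsub : {v : Site 2 | 0 < v 0} ≤ negFlip {v : Site 2 | 0 < v 0} := by
    intro v hv
    simp only [mem_negFlip, mem_setOf_eq, Pi.neg_apply, not_lt] at hv ⊢
    omega
  exact isUpperSet_sepOpenArm n N hsub (halfPlane_mem_sepOpenArm hn hnN)

/-- **The well-separated two-arm event has positive probability** for `16 ≤ n ≤ N`: it is
determined by the sites of `Λ_{N + N/8}` and contains the right half-plane configuration, hence
the cylinder event of the configurations agreeing with it on `Λ_{N + N/8}`, which has positive
`P_{1/2}`-probability. This is the necessary condition `P_{1/2}(sepTwoArm n N) > 0` for the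
named fact `Nolin2008_twoArm_separation` (`c · b(n, N) ≤ P_{1/2}(sepTwoArm n N)` with
`b(n, N) > 0`, `polyArmProb_twoArm_pos`) — a consistency check of its Lean rendering, not a
proof of it. [cite: Nolin2008, Thm. 11 (arXiv 0711.4948: Thm. 10)] -/
theorem triSitePercolation_sepTwoArm_pos {n N : ℕ} (hn : 16 ≤ n) (hnN : n ≤ N) :
    0 < (triSitePercolation half).real (sepTwoArm n N) := by
  classical
  have dS : DeterminedBy (sepTwoArm n N) ↑(triBall (N + N / 8)) := by
    refine ((determinedBy_sepOpenArm hnN).mono ?_).inter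
      ((determinedBy_sepOpenArm hnN).preimage_negFlip.mono ?_)
    · intro v hv
      rw [mem_sepSupportSet] at hv
      simp only [Finset.mem_coe, mem_triBall_iff]
      push_cast; omega
    · intro v hv
      rw [Set.mem_preimage, mem_sepSupportSet, triNorm_neg] at hv
      simp only [Finset.mem_coe, mem_triBall_iff]
      push_cast; omega
  have hcyl : {ω : Set (Site 2) | ∀ v ∈ triBall (N + N / 8), (v ∈ ω ↔ 0 < v 0)} ⊆ sepTwoArm n N := by
    intro ω hω
    have heq : ω ∩ ↑(triBall (N + N / 8)) = {v : Site 2 | 0 < v 0} ∩ ↑(triBall (N + N / 8)) := by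
      ext v
      simp only [mem_inter_iff, Finset.mem_coe, mem_setOf_eq]
      constructor
      · rintro ⟨h1, h2⟩; exact ⟨(hω v h2).1 h1, h2⟩
      · rintro ⟨h1, h2⟩; exact ⟨(hω v h2).2 h1, h2⟩
    exact ((determinedBy_iff _ _).1 dS ω {v : Site 2 | 0 < v 0} heq).2 (halfPlane_mem_sepTwoArm hn hnN)
  exact (TwoArmPos.triSitePercolation_half_cylinder_pos (triBall (N + N / 8)) (fun v => 0 < v 0)).trans_le
    (measureReal_mono hcyl (measure_ne_top _ _))

end Literature.Probability.Percolation
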